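import Mathlib.LinearAlgebra.Matrix.SpecialLinearGroup
import Mathlib.NumberTheory.SumTwoSquares
import Mathlib.GroupTheory.QuotientGroup.Basic
import Mathlib.GroupTheory.Sylow
import Mathlib.GroupTheory.SpecificGroups.Cyclic
import Mathlib.FieldTheory.IsAlgClosed.AlgebraicClosure
import Mathlib.RingTheory.IntegralDomain
import Literature.GroupTheory.CentralExtensionDicyclicTransfer
import Literature.GroupTheory.SpecificGroups.SL2OddPrimeStableCharacterExtension
import HarnessLib

/-!
# EXT-CRIT for `SL₂(𝔽_q)`, `q` an odd prime, HOLDS: `sl2ZModOddPrime_existsUnique_extension_of_stable_character_holds` (re-homed proof)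

Family `bsd` material RE-HOMED into `Literature/` by the Hodge foundations lane (`lit-hodgefound`, seat p20, generation 35):
verbatim ports of `Summits/BirchSwinnertonDyer/BirchSwinnertonDyer/Theorems/ManinLocalTwoThreeSL2OddPrime{SquareRoots,Normalizer,
StableCharacterExtension}.lean` (cell bsd-f2-manin; Parts 1–3 in dependency order, each with its original module docstring),
namespaces `Summit.BirchSwinnertonDyer.BirchSwinnertonDyer.Theorems[.ManinLocalTwoThree].SL2ZModOddPrime` re-rooted as
`Literature.GroupTheory.SpecificGroups.SL2ZModOddPrime` and `Summit.BirchSwinnertonDyer.BirchSwinnertonDyer.Theorems` as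
`Literature.GroupTheory.SpecificGroups` (so Part 3's apex IS the exact discharge
`Literature.GroupTheory.SpecificGroups.sl2ZModOddPrime_existsUnique_extension_of_stable_character_holds`); the route stub alias
`stub_sl2OddPrimeExtensionFact` is NOT ported (it stays route-side); theorems only (no definition, no named fact), imports
Literature/Mathlib only; `[folklore]` helpers privatised.  WHY: this is the only proof in the tree of the Literature named fact
`sl2ZModOddPrime_existsUnique_extension_of_stable_character` (`SL2OddPrimeStableCharacterExtension.lean`; derived reading of
Fiedorowicz–Priddy 1978 VI.5.4, proved WITHOUT cohomology by transfer to the odd-index dicyclic normaliser `N(⟨w⟩)`: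
square roots of `−1` in `SL₂(𝔽_q)`, the cyclic torus `C(w)` of order divisible by `4`, the Sylow argument, and the tree's
`existsUnique_extension_of_stable_of_dicyclic_oddIndex`), which `Literature/` could not import.  Sibling already in
`Literature/`: the characteristic-`3` variant `SL2PrimeStableCharacterExtensionCharThreeProofs` (namespace `SL2ZModPrimeOrderThree`,
which re-proves `closure_pow_eq_one_eq_top`; kept separate here to stay verbatim).  The Summits originals stay in place
(transitional duplication; cited here).
-/

noncomputable section

/-!
## Part 1 — port of `Summits/BirchSwinnertonDyer/BirchSwinnertonDyer/Theorems/ManinLocalTwoThreeSL2OddPrimeSquareRoots.lean`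

# `SL₂(𝔽_q)`, `q` an odd prime: involutions, square roots of `-1`, and homomorphisms of exponent `2`

Summit `BirchSwinnertonDyer`, route `ManinLocalTwoThree` (cell bsd-f2-manin), crux C2 `ManinOddAtFour`
(stmt-BirchSwinnertonDyer-22967), line `kato_shift_two` v7, registered stub `stub_sl2OddPrimeExtensionFact :
sl2ZModOddPrime_existsUnique_extension_of_stable_character` (the named Literature fact F-es-27′,
`Literature/GroupTheory/SpecificGroups/SL2OddPrimeStableCharacterExtension.lean`, a derived reading of
Fiedorowicz–Priddy 1978 VI.5.4).  This is MODULE A/1 of an ELEMENTARY proof of that fact (no cohomology ring, no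
Schur-multiplier theory): pure `2 × 2` matrix algebra in `SL(2, ZMod q)` for an odd prime `q`:

* `eq_one_or_eq_neg_one_of_mul_self_eq_one` — `-1` is the unique involution (`g² = 1 ⇒ g = ±1`);
* `monoidHom_eq_one_of_forall_mul_self_eq_one` — a homomorphism `SL₂(𝔽_q) → M` all of whose values square to `1`
  is trivial (every element is a product of four elementary unipotents, and a unipotent `u(a) = u(a/2)²` is a
  square); `monoidHom_eq_one_of_forall_mul_self_eq_one_of_ker_le` — the same for a group `E` surjecting onto
  `SL₂(𝔽_q)` (used twice downstream: lifts of `-1` are central in every central extension with exponent-`2` kernel,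
  and UNIQUENESS of the extended character);
* `add_eq_zero_of_mul_self_eq_neg_one` — an element with `x² = -1` has trace `0`;
* `exists_conj_eq_of_mul_self_eq_neg_one` — any two elements with square `-1` are conjugate IN `SL₂(𝔽_q)`
  (conjugate to `w = (0 -1; 1 0)` by `[v | xv]·m` with `m` in the centraliser torus of `w` chosen by the two-squares
  identity `ZMod.sq_add_sq` so that the determinant is `1`).

No definitions; nothing about BSD or the Manin constant is asserted here.  Standard material (L. E. Dickson,
*Linear Groups* (1901), Ch. XII; B. Huppert, *Endliche Gruppen I*, II §8).
-/

section Part1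

set_option autoImplicit false

open scoped MatrixGroups

namespace Literature.GroupTheory.SpecificGroups

namespace SL2ZModOddPrime

variable {q : ℕ} [Fact q.Prime]

/-- In `ZMod q`, `q` an odd prime, `2 ≠ 0` (as a `NeZero` fact; cf. `two_ne_zero_zmod` in the X6 certificate
files, not imported here to keep this module light). [folklore] -/
private theorem neZero_two (hq : q ≠ 2) : NeZero (2 : ZMod q) := by
  constructor
  intro h
  have h' : ((2 : ℕ) : ZMod q) = 0 := by exact_mod_cast h
  rw [ZMod.natCast_eq_zero_iff] at h'
  have h2 : q ≤ 2 := Nat.le_of_dvd (by norm_num) h'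
  have h3 : 2 ≤ q := (Fact.out : q.Prime).two_le
  exact hq (le_antisymm h2 h3)

/-- In `SL(2, ZMod q)`, `q` an odd prime, `-1 ≠ 1`. [folklore] -/
private theorem neg_one_ne_one (hq : q ≠ 2) : (-1 : SL(2, ZMod q)) ≠ 1 := by
  intro h
  have h00 := congrArg (fun m : SL(2, ZMod q) => (m : Matrix (Fin 2) (Fin 2) (ZMod q)) 0 0) h
  simp only [Matrix.SpecialLinearGroup.coe_neg, Matrix.SpecialLinearGroup.coe_one, Matrix.neg_apply,
    Matrix.one_apply_eq] at h00
  apply (neZero_two hq).out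
  linear_combination -h00

/-- Entries of a product in `SL(2, R)` (plumbing). [folklore] -/
private theorem mul_apply_two {R : Type*} [CommRing R] (g h : SL(2, R)) (i j : Fin 2) :
    (g * h) i j = g i 0 * h 0 j + g i 1 * h 1 j := by
  simp [Matrix.SpecialLinearGroup.coe_mul, Matrix.mul_apply, Fin.sum_univ_two]

/-- The determinant relation of an element of `SL(2, R)` (plumbing). [folklore] -/
private theorem det_two {R : Type*} [CommRing R] (g : SL(2, R)) : g 0 0 * g 1 1 - g 0 1 * g 1 0 = 1 := by
  have := g.det_coe
  rw [Matrix.det_fin_two] at this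
  exact this

/-- **`-1` is the unique involution of `SL₂(𝔽_q)`, `q` odd**: `g * g = 1` forces `g = 1` or `g = -1`.
[folklore] -/
private theorem eq_one_or_eq_neg_one_of_mul_self_eq_one (hq : q ≠ 2) (g : SL(2, ZMod q)) (h : g * g = 1) :
    g = 1 ∨ g = -1 := by
  have h00 := congrArg (fun m : SL(2, ZMod q) => m 0 0) h
  have h01 := congrArg (fun m : SL(2, ZMod q) => m 0 1) h
  have h10 := congrArg (fun m : SL(2, ZMod q) => m 1 0) h
  have h11 := congrArg (fun m : SL(2, ZMod q) => m 1 1) h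
  simp only [mul_apply_two, Matrix.SpecialLinearGroup.coe_one, Matrix.one_apply_eq, Matrix.one_apply_ne,
    ne_eq, zero_ne_one, not_false_eq_true, one_ne_zero] at h00 h01 h10 h11
  have hdet := det_two g
  by_cases had : g 0 0 + g 1 1 = 0
  · exfalso
    apply (neZero_two hq).out
    have h11' : g 1 1 = -g 0 0 := by linear_combination had
    rw [h11'] at hdet
    linear_combination -h00 - hdet
  · have hb : g 0 1 = 0 := by
      have : g 0 1 * (g 0 0 + g 1 1) = 0 := by linear_combination h01
      rcases mul_eq_zero.1 this with h | h
      · exact h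
      · exact absurd h had
    have hc : g 1 0 = 0 := by
      have : g 1 0 * (g 0 0 + g 1 1) = 0 := by linear_combination h10
      rcases mul_eq_zero.1 this with h | h
      · exact h
      · exact absurd h had
    rw [hb] at h00
    have ha : (g 0 0 - 1) * (g 0 0 + 1) = 0 := by linear_combination h00
    rcases mul_eq_zero.1 ha with ha | ha
    · left
      have ha' : g 0 0 = 1 := by linear_combination ha
      have hd' : g 1 1 = 1 := by
        rw [ha', hb, hc] at hdet; linear_combination hdet
      ext i j
      fin_cases i <;> fin_cases j <;> simp [ha', hb, hc, hd']
    · right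
      have ha' : g 0 0 = -1 := by linear_combination ha
      have hd' : g 1 1 = -1 := by
        rw [ha', hb, hc] at hdet; linear_combination -hdet
      ext i j
      fin_cases i <;> fin_cases j <;>
        simp [ha', hb, hc, hd', Matrix.SpecialLinearGroup.coe_neg]

/-- **A homomorphism on `SL₂(𝔽_q)` (`q` odd) all of whose values square to `1` is trivial.**  Every element is a
product of (at most four) elementary unipotent matrices, and an elementary unipotent `u(a) = u(a/2)²` is a square.
(So `SL₂(𝔽_q)` has no non-trivial homomorphism to a group of exponent `2`.) [folklore] -/
private theorem monoidHom_eq_one_of_forall_mul_self_eq_one (hq : q ≠ 2) {M : Type*} [Group M]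
    (f : SL(2, ZMod q) →* M) (hf : ∀ x, f x * f x = 1) : f = 1 := by
  have h2 := (neZero_two hq).out
  -- elementary unipotents
  let U : ZMod q → SL(2, ZMod q) := fun a => ⟨!![1, a; 0, 1], by simp [Matrix.det_fin_two_of]⟩
  let L : ZMod q → SL(2, ZMod q) := fun a => ⟨!![1, 0; a, 1], by simp [Matrix.det_fin_two_of]⟩
  have hU : ∀ a b, U a * U b = U (a + b) := fun a b => by
    ext i j
    fin_cases i <;> fin_cases j <;> simp [U, Matrix.mul_apply, Fin.sum_univ_two]
    ring
  have hL : ∀ a b, L a * L b = L (a + b) := fun a b => by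
    ext i j
    fin_cases i <;> fin_cases j <;> simp [L, Matrix.mul_apply, Fin.sum_univ_two]
  have hfU : ∀ a, f (U a) = 1 := fun a => by
    have : U a = U (a / 2) * U (a / 2) := by rw [hU]; congr 1; field_simp; ring
    rw [this, map_mul]; exact hf _
  have hfL : ∀ a, f (L a) = 1 := fun a => by
    have : L a = L (a / 2) * L (a / 2) := by rw [hL]; congr 1; field_simp; ring
    rw [this, map_mul]; exact hf _
  -- elements with non-zero lower-left entry
  have key : ∀ g : SL(2, ZMod q), g 1 0 ≠ 0 → f g = 1 := by
    intro g hc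
    have hdet := det_two g
    have e00 : (U ((g 0 0 - 1) / g 1 0) * L (g 1 0) * U ((g 1 1 - 1) / g 1 0)) 0 0 = g 0 0 := by
      simp only [mul_apply_two]; simp [U, L]; field_simp; ring
    have e01 : (U ((g 0 0 - 1) / g 1 0) * L (g 1 0) * U ((g 1 1 - 1) / g 1 0)) 0 1 = g 0 1 := by
      simp only [mul_apply_two]; simp [U, L]; field_simp; linear_combination hdet
    have e10 : (U ((g 0 0 - 1) / g 1 0) * L (g 1 0) * U ((g 1 1 - 1) / g 1 0)) 1 0 = g 1 0 := by
      simp only [mul_apply_two]; simp [U, L]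
    have e11 : (U ((g 0 0 - 1) / g 1 0) * L (g 1 0) * U ((g 1 1 - 1) / g 1 0)) 1 1 = g 1 1 := by
      simp only [mul_apply_two]; simp [U, L]; field_simp; ring
    have hg : g = U ((g 0 0 - 1) / g 1 0) * L (g 1 0) * U ((g 1 1 - 1) / g 1 0) := by
      ext i j
      fin_cases i <;> fin_cases j
      · exact e00.symm
      · exact e01.symm
      · exact e10.symm
      · exact e11.symm
    rw [hg, map_mul, map_mul, hfU, hfL, hfU, one_mul, one_mul]
  ext g
  simp only [MonoidHom.one_apply]
  by_cases hc : g 1 0 = 0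
  · have hdet := det_two g
    rw [hc, mul_zero, sub_zero] at hdet
    have ha : g 0 0 ≠ 0 := fun h0 => by rw [h0, zero_mul] at hdet; exact zero_ne_one hdet
    have h1 : f (L 1 * g) = 1 := key (L 1 * g) (by simpa [mul_apply_two, L, hc] using ha)
    rwa [map_mul, hfL, one_mul] at h1
  · exact key g hc

/-- **Relative version.**  If `π : E → SL₂(𝔽_q)` is surjective (`q` odd) and `f : E → M` is a homomorphism which kills
`ker π` and all of whose values square to `1`, then `f` is trivial. [folklore] -/
private theorem monoidHom_eq_one_of_forall_mul_self_eq_one_of_ker_le (hq : q ≠ 2) {E M : Type*} [Group E] [Group M]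
    (π : E →* SL(2, ZMod q)) (hπ : Function.Surjective π) (f : E →* M) (hker : π.ker ≤ f.ker)
    (hf : ∀ x, f x * f x = 1) : f = 1 := by
  let e : E ⧸ π.ker ≃* SL(2, ZMod q) := QuotientGroup.quotientKerEquivOfSurjective π hπ
  let fbar : E ⧸ π.ker →* M := QuotientGroup.lift π.ker f hker
  let g : SL(2, ZMod q) →* M := fbar.comp e.symm.toMonoidHom
  have hg : g = 1 := by
    refine monoidHom_eq_one_of_forall_mul_self_eq_one hq g fun x => ?_
    obtain ⟨y, rfl⟩ := e.surjective x
    obtain ⟨z, rfl⟩ := QuotientGroup.mk_surjective y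
    simp [g, fbar, hf]
  ext z
  have := DFunLike.congr_fun hg (e (QuotientGroup.mk z))
  simpa [g, fbar] using this

/-- **An element of `SL₂(𝔽_q)` (`q` odd) with `x² = -1` has trace zero** and satisfies `x₀₀² + x₀₁x₁₀ = -1`.
[folklore] -/
private theorem add_eq_zero_of_mul_self_eq_neg_one (hq : q ≠ 2) (x : SL(2, ZMod q)) (hx : x * x = -1) :
    x 0 0 + x 1 1 = 0 ∧ x 0 0 * x 0 0 + x 0 1 * x 1 0 = -1 := by
  have h00 := congrArg (fun m : SL(2, ZMod q) => m 0 0) hx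
  have h01 := congrArg (fun m : SL(2, ZMod q) => m 0 1) hx
  have h10 := congrArg (fun m : SL(2, ZMod q) => m 1 0) hx
  have h11 := congrArg (fun m : SL(2, ZMod q) => m 1 1) hx
  simp only [mul_apply_two, Matrix.SpecialLinearGroup.coe_neg, Matrix.SpecialLinearGroup.coe_one,
    Matrix.neg_apply, Matrix.one_apply_eq, Matrix.one_apply_ne, ne_eq, zero_ne_one, not_false_eq_true,
    one_ne_zero, neg_zero] at h00 h01 h10 h11
  have hdet := det_two x
  refine ⟨?_, h00⟩
  by_contra had
  have hb : x 0 1 = 0 := by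
    have : x 0 1 * (x 0 0 + x 1 1) = 0 := by linear_combination h01
    rcases mul_eq_zero.1 this with h | h
    · exact h
    · exact absurd h had
  have hc : x 1 0 = 0 := by
    have : x 1 0 * (x 0 0 + x 1 1) = 0 := by linear_combination h10
    rcases mul_eq_zero.1 this with h | h
    · exact h
    · exact absurd h had
  rw [hb] at h00 hdet
  rw [hc] at h11
  -- `x₀₀² = -1 = x₁₁²`, `x₀₀ x₁₁ = 1`
  have hsub : (x 0 0 - x 1 1) * (x 0 0 + x 1 1) = 0 := by linear_combination h00 - h11
  rcases mul_eq_zero.1 hsub with h | h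
  · have h' : x 1 1 = x 0 0 := by linear_combination -h
    rw [h'] at hdet
    apply (neZero_two hq).out
    linear_combination h00 - hdet
  · exact had h

/-- **Any two square roots of `-1` in `SL₂(𝔽_q)` (`q` odd) are conjugate in `SL₂(𝔽_q)`.**  (They are conjugate to
`w = (0 -1; 1 0)` by `g = [v | xv]·m` with `m` in the centraliser torus of `w` chosen, by the two-squares identity
in `𝔽_q`, so that `det g = 1`.) [folklore] -/
private theorem exists_conj_eq_of_mul_self_eq_neg_one (hq : q ≠ 2) (x y : SL(2, ZMod q)) (hx : x * x = -1)
    (hy : y * y = -1) : ∃ g : SL(2, ZMod q), g * x * g⁻¹ = y := by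
  have h2 := (neZero_two hq).out
  let w : SL(2, ZMod q) := ⟨!![0, -1; 1, 0], by simp [Matrix.det_fin_two_of]⟩
  -- Step 1: an `x` with `x² = -1` and `x₁₀ ≠ 0` is conjugate to `w`.
  have key : ∀ x : SL(2, ZMod q), x * x = -1 → x 1 0 ≠ 0 → ∃ g : SL(2, ZMod q), g * w * g⁻¹ = x := by
    intro x hx hc
    obtain ⟨htr, hrel⟩ := add_eq_zero_of_mul_self_eq_neg_one hq x hx
    obtain ⟨u, v, huv⟩ := ZMod.sq_add_sq q (x 1 0)⁻¹
    have hdetg : Matrix.det !![u + x 0 0 * v, -v + x 0 0 * u; x 1 0 * v, x 1 0 * u] = 1 := by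
      rw [Matrix.det_fin_two_of]
      have : x 1 0 * (x 1 0)⁻¹ = 1 := mul_inv_cancel₀ hc
      linear_combination x 1 0 * huv + this
    refine ⟨⟨_, hdetg⟩, ?_⟩
    rw [mul_inv_eq_iff_eq_mul]
    ext i j
    fin_cases i <;> fin_cases j <;> simp [w, Matrix.mul_apply, Fin.sum_univ_two]
    · linear_combination (-v) * hrel
    · linear_combination (-u) * hrel
    · linear_combination (-(x 1 0 * v)) * htr
    · linear_combination (-(x 1 0 * u)) * htr
  -- Step 2: every `x` with `x² = -1` is conjugate to `w`.
  have key2 : ∀ x : SL(2, ZMod q), x * x = -1 → ∃ g : SL(2, ZMod q), g * w * g⁻¹ = x := by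
    intro x hx
    by_cases hc : x 1 0 = 0
    · by_cases hb : x 0 1 = 0
      · -- diagonal case: conjugate by the lower unipotent `l`
        obtain ⟨htr, hrel⟩ := add_eq_zero_of_mul_self_eq_neg_one hq x hx
        let l : SL(2, ZMod q) := ⟨!![1, 0; 1, 1], by simp [Matrix.det_fin_two_of]⟩
        have hx' : l * x * l⁻¹ * (l * x * l⁻¹) = -1 := by
          calc l * x * l⁻¹ * (l * x * l⁻¹) = l * (x * x) * l⁻¹ := by group
            _ = -1 := by rw [hx]; simp
        have ha : x 0 0 ≠ 0 := by
          intro h0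
          rw [h0, hb] at hrel
          simp at hrel
        have hc' : (l * x * l⁻¹) 1 0 ≠ 0 := by
          have e : (l * x * l⁻¹) 1 0 = 2 * x 0 0 := by
            simp only [mul_apply_two]
            simp [l, Matrix.SpecialLinearGroup.coe_inv, Matrix.adjugate_fin_two, hb, hc]
            linear_combination -htr
          rw [e]
          exact mul_ne_zero h2 ha
        obtain ⟨g, hg⟩ := key _ hx' hc'
        refine ⟨l⁻¹ * g, ?_⟩
        calc l⁻¹ * g * w * (l⁻¹ * g)⁻¹ = l⁻¹ * (g * w * g⁻¹) * l := by group
          _ = x := by rw [hg]; group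
      · -- `x₁₀ = 0`, `x₀₁ ≠ 0`: conjugate by `w`
        have hx' : w * x * w⁻¹ * (w * x * w⁻¹) = -1 := by
          calc w * x * w⁻¹ * (w * x * w⁻¹) = w * (x * x) * w⁻¹ := by group
            _ = -1 := by rw [hx]; simp
        have hc' : (w * x * w⁻¹) 1 0 ≠ 0 := by
          have e : (w * x * w⁻¹) 1 0 = -x 0 1 := by
            simp only [mul_apply_two]
            simp [w, Matrix.SpecialLinearGroup.coe_inv, Matrix.adjugate_fin_two, hc]
          rw [e]
          exact neg_ne_zero.2 hb
        obtain ⟨g, hg⟩ := key _ hx' hc'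
        refine ⟨w⁻¹ * g, ?_⟩
        calc w⁻¹ * g * w * (w⁻¹ * g)⁻¹ = w⁻¹ * (g * w * g⁻¹) * w := by group
          _ = x := by rw [hg]; group
    · exact key x hx hc
  obtain ⟨gx, hgx⟩ := key2 x hx
  obtain ⟨gy, hgy⟩ := key2 y hy
  refine ⟨gy * gx⁻¹, ?_⟩
  calc gy * gx⁻¹ * x * (gy * gx⁻¹)⁻¹ = gy * (gx⁻¹ * x * gx) * gy⁻¹ := by group
    _ = gy * w * gy⁻¹ := by rw [← hgx]; group
    _ = y := hgy

end SL2ZModOddPrime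

end Literature.GroupTheory.SpecificGroups

end Part1

/-!
## Part 2 — port of `Summits/BirchSwinnertonDyer/BirchSwinnertonDyer/Theorems/ManinLocalTwoThreeSL2OddPrimeNormalizer.lean`

# `SL₂(𝔽_q)`, `q` an odd prime: the normaliser of a cyclic subgroup of order `4` has odd index

Summit `BirchSwinnertonDyer`, route `ManinLocalTwoThree` (cell bsd-f2-manin), crux C2 `ManinOddAtFour`
(stmt-BirchSwinnertonDyer-22967), line `kato_shift_two` v7, stub `stub_sl2OddPrimeExtensionFact` (= Literature fact
F-es-27′ `sl2ZModOddPrime_existsUnique_extension_of_stable_character`).  MODULE A/2 of its elementary proof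
(companion of `ManinLocalTwoThreeSL2OddPrimeSquareRoots.lean`).  For `s ∈ SL₂(𝔽_q)` with `s² = -1`: `orderOf_eq_four`;
`mem_normalizer_zpowers_iff` (`g` normalises `⟨s⟩` iff `g s g⁻¹ ∈ {s, s⁻¹}`); `not_two_dvd_index_normalizer_zpowers` —
**`N(⟨s⟩)` has ODD index** (a Sylow `2`-subgroup `P` contains `-1`; a central involution of `P/⟨-1⟩` lifts to
`y ∈ P` with `y² = -1`, `⟨y⟩ ⊴ P`, so `P ≤ N(⟨y⟩)`, conjugate to `N(⟨s⟩)` since all square roots of `-1` are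
conjugate).  For the model `w = (0 -1; 1 0)`: its centraliser is `{(p -r; r p)}`, CYCLIC (it embeds in an
algebraically closed field via `p + r·i`), of order divisible by `4`; any `j` with `j w j⁻¹ = w⁻¹` has `j² = -1` and
inverts the whole torus.  No definitions; nothing about BSD or the Manin constant is asserted here.  Standard material
(Dickson, *Linear Groups*, Ch. XII; Huppert, *Endliche Gruppen I*, II §8).
-/

section Part2

set_option autoImplicit false

open scoped MatrixGroups Pointwise

namespace Literature.GroupTheory.SpecificGroups

namespace SL2ZModOddPrime

variable {q : ℕ} [Fact q.Prime]

omit [Fact q.Prime] in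
/-- `s² = -1 ⇒ s⁻¹ = -s` (plumbing). [folklore] -/
private theorem inv_eq_neg {s : SL(2, ZMod q)} (hs : s * s = -1) : s⁻¹ = -s := by
  rw [inv_eq_iff_mul_eq_one, mul_neg, hs, neg_neg]

/-- `s² = -1 ⇒ s` has order `4` (`q` odd). [folklore] -/
private theorem orderOf_eq_four (hq : q ≠ 2) {s : SL(2, ZMod q)} (hs : s * s = -1) : orderOf s = 4 := by
  haveI : Fact (Nat.Prime 2) := ⟨Nat.prime_two⟩
  have h2 : s ^ 2 = -1 := by rw [pow_two, hs]
  have h : orderOf s = 2 ^ (1 + 1) := by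
    apply orderOf_eq_prime_pow
    · rw [pow_one, h2]; exact neg_one_ne_one hq
    · rw [show 2 ^ (1 + 1) = 2 * 2 from rfl, pow_mul, h2]; simp
  simpa using h

/-- **Normaliser of `⟨s⟩`, `s² = -1`**: `g` normalises `⟨s⟩` iff `g s g⁻¹ = s` or `g s g⁻¹ = s⁻¹`. [folklore] -/
private theorem mem_normalizer_zpowers_iff (hq : q ≠ 2) {s : SL(2, ZMod q)} (hs : s * s = -1) (g : SL(2, ZMod q)) :
    g ∈ Subgroup.normalizer (Subgroup.zpowers s : Set (SL(2, ZMod q))) ↔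
      g * s * g⁻¹ = s ∨ g * s * g⁻¹ = s⁻¹ := by
  classical
  constructor
  · intro hg
    have hmem : g * s * g⁻¹ ∈ Subgroup.zpowers s :=
      (Subgroup.mem_normalizer_iff.1 hg s).1 (Subgroup.mem_zpowers s)
    rw [mem_zpowers_iff_mem_range_orderOf, Finset.mem_image] at hmem
    obtain ⟨n, hn, hns⟩ := hmem
    rw [Finset.mem_range, orderOf_eq_four hq hs] at hn
    interval_cases n
    · exfalso
      rw [pow_zero] at hns
      have : s = 1 := by
        have := hns.symm
        rwa [mul_inv_eq_one, mul_eq_left] at this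
      rw [this, mul_one] at hs
      exact neg_one_ne_one hq hs.symm
    · left; rw [← hns, pow_one]
    · exfalso
      rw [pow_two, hs] at hns
      have : s = -1 := by
        have h1 := hns.symm
        rw [mul_inv_eq_iff_eq_mul] at h1
        -- `g s = -1 * g = -g`
        have : g * s = g * (-1) := by rw [h1]; simp
        exact mul_left_cancel this
      rw [this] at hs
      apply neg_one_ne_one hq
      simpa using hs.symm
    · right
      rw [← hns, pow_succ, pow_two, hs, inv_eq_neg hs]
      simp
  · intro hg
    -- in either case, conjugation by `g` and by `g⁻¹` maps `s` to `s ^ ε`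
    have hfwd : ∃ ε : ℤ, g * s * g⁻¹ = s ^ ε := by
      rcases hg with h | h
      · exact ⟨1, by rw [h, zpow_one]⟩
      · exact ⟨-1, by rw [h, zpow_neg_one]⟩
    have hbwd : ∃ ε : ℤ, g⁻¹ * s * g = s ^ ε := by
      rcases hg with h | h
      · refine ⟨1, ?_⟩
        rw [zpow_one]
        calc g⁻¹ * s * g = g⁻¹ * (g * s * g⁻¹) * g := by rw [h]
          _ = s := by group
      · refine ⟨-1, ?_⟩
        have h' : g * s⁻¹ * g⁻¹ = s := by
          have := congrArg (·⁻¹) h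
          simpa only [mul_inv_rev, inv_inv, mul_assoc] using this
        rw [zpow_neg_one]
        calc g⁻¹ * s * g = g⁻¹ * (g * s⁻¹ * g⁻¹) * g := by rw [h']
          _ = s⁻¹ := by group
    obtain ⟨ε, hε⟩ := hfwd
    obtain ⟨δ, hδ⟩ := hbwd
    rw [Subgroup.mem_normalizer_iff]
    intro h
    constructor
    · intro hh
      obtain ⟨k, rfl⟩ := Subgroup.mem_zpowers_iff.1 hh
      rw [← conj_zpow, hε, ← zpow_mul]
      exact Subgroup.zpow_mem_zpowers _ _
    · intro hh
      obtain ⟨k, hk⟩ := Subgroup.mem_zpowers_iff.1 hh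
      have : h = g⁻¹ * s ^ k * g := by rw [hk]; group
      rw [this, show g⁻¹ * s ^ k * g = (g⁻¹ * s * g⁻¹⁻¹) ^ k by rw [conj_zpow, inv_inv], inv_inv, hδ, ← zpow_mul]
      exact Subgroup.zpow_mem_zpowers _ _

/-- `-1` lies in every subgroup of `SL₂(𝔽_q)` (`q` odd) of even order — in particular in every Sylow `2`-subgroup
once some element of order `4` exists (plumbing for the odd-index theorem). [folklore] -/
private theorem neg_one_mem_of_two_dvd_card (hq : q ≠ 2) (P : Subgroup (SL(2, ZMod q))) (h2 : 2 ∣ Nat.card P) :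
    (-1 : SL(2, ZMod q)) ∈ P := by
  haveI : Fact (Nat.Prime 2) := ⟨Nat.prime_two⟩
  obtain ⟨z, hz⟩ := exists_prime_orderOf_dvd_card' (G := P) 2 h2
  have hz' : z ^ 2 = 1 := by have := pow_orderOf_eq_one z; rwa [hz] at this
  have hz2 : (z : SL(2, ZMod q)) * z = 1 := by
    rw [← Subgroup.coe_mul, ← pow_two, hz', Subgroup.coe_one]
  rcases eq_one_or_eq_neg_one_of_mul_self_eq_one hq _ hz2 with h | h
  · exfalso
    have : z = 1 := Subtype.ext h
    rw [this, orderOf_one] at hz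
    exact absurd hz (by norm_num)
  · rw [← h]; exact z.2

/-- **The normaliser of a cyclic subgroup of order `4` in `SL₂(𝔽_q)` (`q` odd) has odd index** (it contains a
Sylow `2`-subgroup).  [folklore] -/
private theorem not_two_dvd_index_normalizer_zpowers (hq : q ≠ 2) {s : SL(2, ZMod q)} (hs : s * s = -1) :
    ¬ 2 ∣ (Subgroup.normalizer (Subgroup.zpowers s : Set (SL(2, ZMod q)))).index := by
  classical
  haveI : Fact (Nat.Prime 2) := ⟨Nat.prime_two⟩
  obtain ⟨P⟩ : Nonempty (Sylow 2 (SL(2, ZMod q))) := inferInstance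
  -- `4 ∣ |P|`, so `-1 ∈ P`
  have h4G : 2 ^ 2 ∣ Nat.card (SL(2, ZMod q)) := by
    have := orderOf_dvd_natCard s; rwa [orderOf_eq_four hq hs] at this
  have h4P : 2 ^ 2 ∣ Nat.card (P : Subgroup (SL(2, ZMod q))) := P.pow_dvd_card_of_pow_dvd_card h4G
  have h2P : 2 ∣ Nat.card (P : Subgroup (SL(2, ZMod q))) := dvd_trans ⟨2, by norm_num⟩ h4P
  have hneg : (-1 : SL(2, ZMod q)) ∈ (P : Subgroup (SL(2, ZMod q))) := neg_one_mem_of_two_dvd_card hq _ h2P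
  -- the central subgroup `Z = ⟨-1⟩` of `P`
  let z : (P : Subgroup (SL(2, ZMod q))) := ⟨-1, hneg⟩
  have hzc : ∀ p : (P : Subgroup (SL(2, ZMod q))), p * z = z * p := fun p => by
    apply Subtype.ext; simp [z]
  have hz2 : orderOf z = 2 := by
    rw [← Subgroup.orderOf_coe]
    refine orderOf_eq_prime ?_ ?_
    · simp [z]
    · simpa [z] using neg_one_ne_one hq
  let Z : Subgroup (P : Subgroup (SL(2, ZMod q))) := Subgroup.zpowers z
  haveI hZn : Z.Normal := by
    refine ⟨fun n hn g => ?_⟩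
    obtain ⟨k, rfl⟩ := Subgroup.mem_zpowers_iff.1 hn
    have : g * z ^ k * g⁻¹ = z ^ k := by
      rw [← conj_zpow]
      congr 1
      rw [mul_inv_eq_iff_eq_mul, hzc]
    rw [this]; exact Subgroup.zpow_mem_zpowers _ _
  have hZcard : Nat.card Z = 2 := by rw [Nat.card_zpowers, hz2]
  -- the quotient `P / Z` is a non-trivial `2`-group; pick a central involution `ȳ`
  have hPq : IsPGroup 2 ((P : Subgroup (SL(2, ZMod q))) ⧸ Z) := P.isPGroup'.to_quotient Z
  haveI : Nontrivial ((P : Subgroup (SL(2, ZMod q))) ⧸ Z) := by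
    rw [← Finite.one_lt_card_iff_nontrivial]
    have hcard := Subgroup.card_eq_card_quotient_mul_card_subgroup Z
    rw [hZcard] at hcard
    have hpos : 0 < Nat.card ((P : Subgroup (SL(2, ZMod q))) ⧸ Z) := Nat.card_pos
    rcases Nat.lt_or_ge 1 (Nat.card ((P : Subgroup (SL(2, ZMod q))) ⧸ Z)) with h | h
    · exact h
    · exfalso
      have h1 : Nat.card ((P : Subgroup (SL(2, ZMod q))) ⧸ Z) = 1 := le_antisymm h hpos
      rw [h1, one_mul] at hcard
      rw [hcard] at h4P
      norm_num at h4P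
  haveI : Nontrivial (Subgroup.center ((P : Subgroup (SL(2, ZMod q))) ⧸ Z)) := hPq.center_nontrivial
  have h2c : 2 ∣ Nat.card (Subgroup.center ((P : Subgroup (SL(2, ZMod q))) ⧸ Z)) := by
    rcases (hPq.to_subgroup (Subgroup.center _)).card_eq_or_dvd with h | h
    · exfalso
      exact (Finite.one_lt_card_iff_nontrivial.2 inferInstance).ne' h
    · exact h
  obtain ⟨yc, hyc⟩ := exists_prime_orderOf_dvd_card' (G := Subgroup.center ((P : Subgroup (SL(2, ZMod q))) ⧸ Z)) 2 h2c
  -- `ȳ := yc`, central of order 2; lift to `y ∈ P`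
  obtain ⟨y, hy⟩ := QuotientGroup.mk_surjective (yc : (P : Subgroup (SL(2, ZMod q))) ⧸ Z)
  have hyc1 : (yc : (P : Subgroup (SL(2, ZMod q))) ⧸ Z) ≠ 1 := by
    intro h
    have : yc = 1 := Subtype.ext h
    rw [this, orderOf_one] at hyc
    exact absurd hyc (by norm_num)
  have hyc2 : (yc : (P : Subgroup (SL(2, ZMod q))) ⧸ Z) ^ 2 = 1 := by
    have := pow_orderOf_eq_one yc; rw [hyc] at this; rw [← Subgroup.coe_pow, this, Subgroup.coe_one]
  have hycc : ∀ x : (P : Subgroup (SL(2, ZMod q))) ⧸ Z, x * yc = yc * x := fun x =>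
    (Subgroup.mem_center_iff.1 yc.2 x)
  -- membership in `Z = {1, z}`
  have hZmem : ∀ x : (P : Subgroup (SL(2, ZMod q))), x ∈ Z → x = 1 ∨ x = z := by
    intro x hx
    rw [mem_zpowers_iff_mem_range_orderOf, Finset.mem_image] at hx
    obtain ⟨n, hn, rfl⟩ := hx
    rw [Finset.mem_range, hz2] at hn
    interval_cases n <;> simp
  -- `y² = -1`
  have hy2 : (y : SL(2, ZMod q)) * y = -1 := by
    have hmem : y * y ∈ Z := by
      rw [← QuotientGroup.eq_one_iff, QuotientGroup.mk_mul, hy, ← pow_two, hyc2]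
    rcases hZmem _ hmem with h | h
    · exfalso
      have h' : (y : SL(2, ZMod q)) * y = 1 := by rw [← Subgroup.coe_mul, h, Subgroup.coe_one]
      rcases eq_one_or_eq_neg_one_of_mul_self_eq_one hq _ h' with h1 | h1
      · apply hyc1
        rw [← hy, QuotientGroup.eq_one_iff]
        have : y = 1 := Subtype.ext h1
        rw [this]; exact Z.one_mem
      · apply hyc1
        rw [← hy, QuotientGroup.eq_one_iff]
        have : y = z := Subtype.ext h1
        rw [this]; exact Subgroup.mem_zpowers z
    · have := congrArg (fun t : (P : Subgroup (SL(2, ZMod q))) => (t : SL(2, ZMod q))) h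
      simpa [z] using this
  -- `P ≤ N(⟨y⟩)`
  have hPle : (P : Subgroup (SL(2, ZMod q))) ≤
      Subgroup.normalizer (Subgroup.zpowers (y : SL(2, ZMod q)) : Set (SL(2, ZMod q))) := by
    intro p hp
    rw [mem_normalizer_zpowers_iff hq hy2]
    let p' : (P : Subgroup (SL(2, ZMod q))) := ⟨p, hp⟩
    have hmem : (p' * y * p'⁻¹)⁻¹ * y ∈ Z := by
      rw [← QuotientGroup.eq, QuotientGroup.mk_mul, QuotientGroup.mk_mul, QuotientGroup.mk_inv, hy,
        hycc, mul_inv_cancel_right]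
    rcases hZmem _ hmem with h | h
    · left
      have : p' * y * p'⁻¹ = y := by
        rw [inv_mul_eq_one] at h; exact h
      have := congrArg (fun t : (P : Subgroup (SL(2, ZMod q))) => (t : SL(2, ZMod q))) this
      simpa [p'] using this
    · right
      have h' : p' * y * p'⁻¹ = y * z⁻¹ := by
        rw [inv_mul_eq_iff_eq_mul] at h
        rw [eq_mul_inv_iff_mul_eq, ← h]
      have := congrArg (fun t : (P : Subgroup (SL(2, ZMod q))) => (t : SL(2, ZMod q))) h'
      simp only [p', Subgroup.coe_mul, Subgroup.coe_inv, z] at this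
      rw [this, inv_eq_neg hy2]
      simp
  -- conjugate `y` to `s`
  obtain ⟨g, hg⟩ := exists_conj_eq_of_mul_self_eq_neg_one hq (y : SL(2, ZMod q)) s hy2 hs
  have hmap : Subgroup.normalizer (Subgroup.zpowers s : Set (SL(2, ZMod q))) =
      Subgroup.map (MulAut.conj g).toMonoidHom
        (Subgroup.normalizer (Subgroup.zpowers (y : SL(2, ZMod q)) : Set (SL(2, ZMod q)))) := by
    rw [Subgroup.map_equiv_normalizer_eq, MonoidHom.map_zpowers]
    congr 2
    simp [hg]
  have hidx : (Subgroup.normalizer (Subgroup.zpowers s : Set (SL(2, ZMod q)))).index =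
      (Subgroup.normalizer (Subgroup.zpowers (y : SL(2, ZMod q)) : Set (SL(2, ZMod q)))).index := by
    rw [hmap, MulEquiv.toMonoidHom_eq_coe, Subgroup.index_map_equiv]
  rw [hidx]
  intro h2
  have hdvd : (Subgroup.normalizer (Subgroup.zpowers (y : SL(2, ZMod q)) : Set (SL(2, ZMod q)))).index ∣
      (P : Subgroup (SL(2, ZMod q))).index :=
    Subgroup.index_dvd_of_le hPle
  exact P.not_dvd_index (dvd_trans h2 hdvd)

/-! ### The model square root `w = (0 -1; 1 0)` and its centraliser torus -/

/-- `w² = -1` for `w = (0 -1; 1 0)`. [folklore] -/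
private theorem mul_self_w {w : SL(2, ZMod q)} (hw : (w : Matrix (Fin 2) (Fin 2) (ZMod q)) = !![0, -1; 1, 0]) :
    w * w = -1 := by
  ext i j
  fin_cases i <;> fin_cases j <;> simp [Matrix.mul_apply, Fin.sum_univ_two, hw]

/-- **The centraliser of `w = (0 -1; 1 0)` in `SL₂(𝔽_q)`** is `{(p -r; r p)}`. [folklore] -/
private theorem mem_centralizer_w_iff {w : SL(2, ZMod q)} (hw : (w : Matrix (Fin 2) (Fin 2) (ZMod q)) = !![0, -1; 1, 0])
    (g : SL(2, ZMod q)) :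
    g ∈ Subgroup.centralizer ({w} : Set (SL(2, ZMod q))) ↔ g 0 1 = -g 1 0 ∧ g 1 1 = g 0 0 := by
  rw [Subgroup.mem_centralizer_singleton_iff]
  constructor
  · intro h
    have h00 := congrArg (fun m : SL(2, ZMod q) => m 0 0) h
    have h10 := congrArg (fun m : SL(2, ZMod q) => m 1 0) h
    simp only [mul_apply_two, hw] at h00 h10
    simp at h00 h10
    exact ⟨by linear_combination h00, by linear_combination h10⟩
  · rintro ⟨h1, h2⟩
    ext i j
    fin_cases i <;> fin_cases j <;> simp [mul_apply_two, hw, h1, h2]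

/-- **The centraliser torus of `w` is cyclic**: it embeds into the multiplicative group of an algebraically closed
field via `(p -r; r p) ↦ p + r·i`, `i² = -1`. [folklore] -/
private theorem isCyclic_centralizer_w (hq : q ≠ 2) {w : SL(2, ZMod q)}
    (hw : (w : Matrix (Fin 2) (Fin 2) (ZMod q)) = !![0, -1; 1, 0]) :
    IsCyclic (Subgroup.centralizer ({w} : Set (SL(2, ZMod q)))) := by
  classical
  let F := AlgebraicClosure (ZMod q)
  obtain ⟨i, hi⟩ := IsAlgClosed.exists_pow_nat_eq (-1 : F) (n := 2) (by norm_num)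
  let ι := algebraMap (ZMod q) F
  have hrel : ∀ g : Subgroup.centralizer ({w} : Set (SL(2, ZMod q))),
      (g : SL(2, ZMod q)) 0 1 = -(g : SL(2, ZMod q)) 1 0 ∧ (g : SL(2, ZMod q)) 1 1 = (g : SL(2, ZMod q)) 0 0 :=
    fun g => (mem_centralizer_w_iff hw _).1 g.2
  let f : Subgroup.centralizer ({w} : Set (SL(2, ZMod q))) →* F :=
    { toFun := fun g => ι ((g : SL(2, ZMod q)) 0 0) + ι ((g : SL(2, ZMod q)) 1 0) * i
      map_one' := by simp [ι]
      map_mul' := fun g h => by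
        obtain ⟨hg1, hg2⟩ := hrel g
        simp only [Subgroup.coe_mul, mul_apply_two, hg1, hg2, map_add, map_mul, map_neg, ι]
        linear_combination (-(algebraMap (ZMod q) F ((g : SL(2, ZMod q)) 1 0) *
          algebraMap (ZMod q) F ((h : SL(2, ZMod q)) 1 0))) * hi }
  refine isCyclic_of_injective_ringHom f ((injective_iff_map_eq_one f).2 fun g hg => ?_)
  obtain ⟨hg1, hg2⟩ := hrel g
  have hdet := det_two (g : SL(2, ZMod q))
  rw [hg1, hg2] at hdet
  -- `a + c i = 1` and `a² + c² = 1`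
  have h1 : ι ((g : SL(2, ZMod q)) 0 0) + ι ((g : SL(2, ZMod q)) 1 0) * i = 1 := hg
  have h2 : ι ((g : SL(2, ZMod q)) 0 0) ^ 2 + ι ((g : SL(2, ZMod q)) 1 0) ^ 2 = 1 := by
    have := congrArg ι hdet
    simp only [map_sub, map_mul, map_neg, map_one, ι] at this
    linear_combination this
  have h3 : ι ((g : SL(2, ZMod q)) 0 0) - ι ((g : SL(2, ZMod q)) 1 0) * i = 1 := by
    linear_combination (-(ι ((g : SL(2, ZMod q)) 0 0) - ι ((g : SL(2, ZMod q)) 1 0) * i)) * h1 + h2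
      - (ι ((g : SL(2, ZMod q)) 1 0)) ^ 2 * hi
  have h2F : (2 : F) ≠ 0 := by
    haveI : CharP F q := inferInstance
    intro h
    have : ((2 : ℕ) : F) = 0 := by exact_mod_cast h
    rw [CharP.cast_eq_zero_iff F q] at this
    have hle : q ≤ 2 := Nat.le_of_dvd (by norm_num) this
    exact hq (le_antisymm hle (Fact.out : q.Prime).two_le)
  have hi0 : i ≠ 0 := by
    intro h0; rw [h0] at hi; norm_num at hi
  have hc : ι ((g : SL(2, ZMod q)) 1 0) = 0 := by
    have : (2 * i) * ι ((g : SL(2, ZMod q)) 1 0) = 0 := by linear_combination h1 - h3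
    rcases mul_eq_zero.1 this with h | h
    · exact absurd h (mul_ne_zero h2F hi0)
    · exact h
  have ha : ι ((g : SL(2, ZMod q)) 0 0) = 1 := by rw [hc] at h1; simpa using h1
  have hc' : (g : SL(2, ZMod q)) 1 0 = 0 := by
    apply (algebraMap (ZMod q) F).injective
    simpa [ι] using hc
  have ha' : (g : SL(2, ZMod q)) 0 0 = 1 := by
    apply (algebraMap (ZMod q) F).injective
    simpa [ι] using ha
  apply Subtype.ext
  ext i' j'
  fin_cases i' <;> fin_cases j' <;> simp [hg1, hg2, ha', hc']

/-- `4` divides the order of the centraliser of an element `s` with `s² = -1` (`s` itself has order `4`).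
[folklore] -/
private theorem four_dvd_card_centralizer (hq : q ≠ 2) {s : SL(2, ZMod q)} (hs : s * s = -1) :
    4 ∣ Nat.card (Subgroup.centralizer ({s} : Set (SL(2, ZMod q)))) := by
  have hmem : s ∈ Subgroup.centralizer ({s} : Set (SL(2, ZMod q))) :=
    Subgroup.mem_centralizer_singleton_iff.2 rfl
  have := orderOf_dvd_natCard (⟨s, hmem⟩ : Subgroup.centralizer ({s} : Set (SL(2, ZMod q))))
  rwa [← Subgroup.orderOf_coe, orderOf_eq_four hq hs] at this

/-- **Shape of an element inverting `w`**: `j w j⁻¹ = w⁻¹` forces `j = (a b; b -a)`. [folklore] -/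
private theorem entries_of_conj_w_eq_inv {w : SL(2, ZMod q)} (hw : (w : Matrix (Fin 2) (Fin 2) (ZMod q)) = !![0, -1; 1, 0])
    (j : SL(2, ZMod q)) (hj : j * w * j⁻¹ = w⁻¹) : j 1 1 = -j 0 0 ∧ j 0 1 = j 1 0 := by
  rw [inv_eq_neg (mul_self_w hw), mul_inv_eq_iff_eq_mul] at hj
  have h00 := congrArg (fun m : SL(2, ZMod q) => m 0 0) hj
  have h01 := congrArg (fun m : SL(2, ZMod q) => m 0 1) hj
  simp only [mul_apply_two, hw] at h00 h01
  simp [Matrix.SpecialLinearGroup.coe_neg, hw] at h00 h01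
  exact ⟨by linear_combination -h01, by linear_combination h00⟩

/-- **An element inverting `w` squares to `-1`.** [folklore] -/
private theorem mul_self_eq_neg_one_of_conj_w_eq_inv {w : SL(2, ZMod q)}
    (hw : (w : Matrix (Fin 2) (Fin 2) (ZMod q)) = !![0, -1; 1, 0]) (j : SL(2, ZMod q)) (hj : j * w * j⁻¹ = w⁻¹) :
    j * j = -1 := by
  obtain ⟨h1, h2⟩ := entries_of_conj_w_eq_inv hw j hj
  have hdet := det_two j
  rw [h1, h2] at hdet
  have e00 : (j * j) 0 0 = -1 := by rw [mul_apply_two, h2]; linear_combination -hdet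
  have e01 : (j * j) 0 1 = 0 := by rw [mul_apply_two, h2, h1]; ring
  have e10 : (j * j) 1 0 = 0 := by rw [mul_apply_two, h1]; ring
  have e11 : (j * j) 1 1 = -1 := by rw [mul_apply_two, h1, h2]; linear_combination -hdet
  ext i j'
  fin_cases i <;> fin_cases j'
  · simpa [Matrix.SpecialLinearGroup.coe_neg] using e00
  · simpa [Matrix.SpecialLinearGroup.coe_neg] using e01
  · simpa [Matrix.SpecialLinearGroup.coe_neg] using e10
  · simpa [Matrix.SpecialLinearGroup.coe_neg] using e11

/-- **An element inverting `w` inverts the whole centraliser torus of `w`** (`j (p -r; r p) j⁻¹ = (p r; -r p)`).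
[folklore] -/
private theorem conj_eq_inv_of_mem_centralizer_w {w : SL(2, ZMod q)}
    (hw : (w : Matrix (Fin 2) (Fin 2) (ZMod q)) = !![0, -1; 1, 0]) (j : SL(2, ZMod q)) (hj : j * w * j⁻¹ = w⁻¹)
    (c : SL(2, ZMod q)) (hc : c ∈ Subgroup.centralizer ({w} : Set (SL(2, ZMod q)))) : j * c * j⁻¹ = c⁻¹ := by
  obtain ⟨h1, h2⟩ := entries_of_conj_w_eq_inv hw j hj
  obtain ⟨hc1, hc2⟩ := (mem_centralizer_w_iff hw c).1 hc
  rw [mul_inv_eq_iff_eq_mul]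
  ext i j'
  fin_cases i <;> fin_cases j' <;>
    simp [mul_apply_two, Matrix.SpecialLinearGroup.coe_inv, Matrix.adjugate_fin_two, h1, h2, hc1, hc2] <;> ring

end SL2ZModOddPrime

end Literature.GroupTheory.SpecificGroups

end Part2

/-!
## Part 3 — port of `Summits/BirchSwinnertonDyer/BirchSwinnertonDyer/Theorems/ManinLocalTwoThreeSL2OddPrimeStableCharacterExtension.lean`

# F-es-27′ is a THEOREM: `sl2ZModOddPrime_existsUnique_extension_of_stable_character` holds — the registered stub
# `stub_sl2OddPrimeExtensionFact` of the line `kato_shift_two` (crux C2 `ManinOddAtFour`) PROVED BY NAME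

Summit `BirchSwinnertonDyer`, route `ManinLocalTwoThree` (cell bsd-f2-manin), deciding crux C2 `ManinOddAtFour`
(stmt-BirchSwinnertonDyer-22967), line `kato_shift_two` v8 (lead p1), registered stub
**`stub_sl2OddPrimeExtensionFact : sl2ZModOddPrime_existsUnique_extension_of_stable_character`** — the named Literature
fact F-es-27′ («EXT-CRIT», `Literature/GroupTheory/SpecificGroups/SL2OddPrimeStableCharacterExtension.lean`; a derived
reading of Fiedorowicz–Priddy 1978 VI.5.4 `H¹ = H² = 0` for `SL₂(𝔽_q)` mod `2`, `q` odd).  It is proved here WITHOUT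
cohomology, by assembling

* the cell typer's abstract criterion `existsUnique_extension_of_stable_of_dicyclic_oddIndex`
  (`Literature/GroupTheory/CentralExtensionDicyclicTransfer.lean`, p610848): a group `Q` generated by elements killed by an
  odd `q` and containing a dicyclic pair `(a, b)` (`b a b⁻¹ = a⁻¹`, `b² = a^k`, `k` even, `a` of order `2k`) generating a
  subgroup of ODD index satisfies EXT-CRIT (transfer to `⟨a, b⟩` + the dicyclic central-extension computation);
* this seat's `SL₂(𝔽_q)` data (`ManinLocalTwoThreeSL2OddPrimeSquareRoots.lean`, `…Normalizer.lean`), UNIFORM in the odd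
  prime `q`: the torus `C(w)` of `w = (0 -1; 1 0)` is cyclic of order divisible by `4`, an element `j` inverting it exists
  (all square roots of `-1` are conjugate) and squares to `-1`, and `N(⟨w⟩) = C(w) ∪ C(w) j = ⟨a, b⟩` has ODD index
  (Sylow argument) — `closure_pow_eq_one_eq_top`, `exists_dicyclic_oddIndex` below.

`sl2ZModOddPrime_existsUnique_extension_of_stable_character_holds` is the fact verbatim; `stub_sl2OddPrimeExtensionFact`
is the registered stub BY NAME.  HONEST FRAMING: this closes ONE of the five named inputs of the lead's conditional
reduction `maninOddAtFour_of_namedInputs`; nothing about BSD or the Manin constant is proved here.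
-/

section Part3

set_option autoImplicit false

open scoped MatrixGroups

namespace Literature.GroupTheory.SpecificGroups

namespace SL2ZModOddPrime

variable {q : ℕ} [Fact q.Prime]

/-- **`SL₂(𝔽_q)` is generated by its elements killed by `q`** (indeed by the elementary unipotents: every element is
`u l u'` or `l⁻¹ u l' u'` with `u, u'` upper and `l, l'` lower unipotent). [folklore] -/
private theorem closure_pow_eq_one_eq_top : Subgroup.closure {g : SL(2, ZMod q) | g ^ q = 1} = ⊤ := by
  -- elementary unipotents and their `q`-th powers
  let U : ZMod q → SL(2, ZMod q) := fun a => ⟨!![1, a; 0, 1], by simp [Matrix.det_fin_two_of]⟩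
  let L : ZMod q → SL(2, ZMod q) := fun a => ⟨!![1, 0; a, 1], by simp [Matrix.det_fin_two_of]⟩
  have hU : ∀ a b, U a * U b = U (a + b) := fun a b => by
    ext i j
    fin_cases i <;> fin_cases j <;> simp [U, Matrix.mul_apply, Fin.sum_univ_two]
    ring
  have hL : ∀ a b, L a * L b = L (a + b) := fun a b => by
    ext i j
    fin_cases i <;> fin_cases j <;> simp [L, Matrix.mul_apply, Fin.sum_univ_two]
  have hUpow : ∀ (a : ZMod q) (n : ℕ), U a ^ n = U (n * a) := fun a n => by
    induction n with
    | zero => simp only [pow_zero, Nat.cast_zero, zero_mul]; ext i j; fin_cases i <;> fin_cases j <;> simp [U]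
    | succ n ih => rw [pow_succ, ih, hU]; congr 1; push_cast; ring
  have hLpow : ∀ (a : ZMod q) (n : ℕ), L a ^ n = L (n * a) := fun a n => by
    induction n with
    | zero => simp only [pow_zero, Nat.cast_zero, zero_mul]; ext i j; fin_cases i <;> fin_cases j <;> simp [L]
    | succ n ih => rw [pow_succ, ih, hL]; congr 1; push_cast; ring
  have hq0 : ((q : ℕ) : ZMod q) = 0 := ZMod.natCast_self q
  have hU0 : U 0 = 1 := by ext i j; fin_cases i <;> fin_cases j <;> simp [U]
  have hL0 : L 0 = 1 := by ext i j; fin_cases i <;> fin_cases j <;> simp [L]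
  have hUS : ∀ a, U a ∈ Subgroup.closure {g : SL(2, ZMod q) | g ^ q = 1} := fun a =>
    Subgroup.subset_closure (show U a ^ q = 1 by rw [hUpow, hq0, zero_mul, hU0])
  have hLS : ∀ a, L a ∈ Subgroup.closure {g : SL(2, ZMod q) | g ^ q = 1} := fun a =>
    Subgroup.subset_closure (show L a ^ q = 1 by rw [hLpow, hq0, zero_mul, hL0])
  -- elements with non-zero lower-left entry are `u l u'`
  have key : ∀ g : SL(2, ZMod q), g 1 0 ≠ 0 → g ∈ Subgroup.closure {g : SL(2, ZMod q) | g ^ q = 1} := by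
    intro g hc
    have hdet := det_two g
    have e00 : (U ((g 0 0 - 1) / g 1 0) * L (g 1 0) * U ((g 1 1 - 1) / g 1 0)) 0 0 = g 0 0 := by
      simp only [mul_apply_two]; simp [U, L]; field_simp; ring
    have e01 : (U ((g 0 0 - 1) / g 1 0) * L (g 1 0) * U ((g 1 1 - 1) / g 1 0)) 0 1 = g 0 1 := by
      simp only [mul_apply_two]; simp [U, L]; field_simp; linear_combination hdet
    have e10 : (U ((g 0 0 - 1) / g 1 0) * L (g 1 0) * U ((g 1 1 - 1) / g 1 0)) 1 0 = g 1 0 := by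
      simp only [mul_apply_two]; simp [U, L]
    have e11 : (U ((g 0 0 - 1) / g 1 0) * L (g 1 0) * U ((g 1 1 - 1) / g 1 0)) 1 1 = g 1 1 := by
      simp only [mul_apply_two]; simp [U, L]; field_simp; ring
    have hg : g = U ((g 0 0 - 1) / g 1 0) * L (g 1 0) * U ((g 1 1 - 1) / g 1 0) := by
      ext i j
      fin_cases i <;> fin_cases j
      · exact e00.symm
      · exact e01.symm
      · exact e10.symm
      · exact e11.symm
    rw [hg]
    exact Subgroup.mul_mem _ (Subgroup.mul_mem _ (hUS _) (hLS _)) (hUS _)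
  rw [eq_top_iff]
  intro g _
  by_cases hc : g 1 0 = 0
  · have hdet := det_two g
    rw [hc, mul_zero, sub_zero] at hdet
    have ha : g 0 0 ≠ 0 := fun h0 => by rw [h0, zero_mul] at hdet; exact zero_ne_one hdet
    have h1 : L 1 * g ∈ Subgroup.closure {g : SL(2, ZMod q) | g ^ q = 1} :=
      key (L 1 * g) (by simpa [mul_apply_two, L, hc] using ha)
    have : g = (L 1)⁻¹ * (L 1 * g) := by group
    rw [this]
    exact Subgroup.mul_mem _ (Subgroup.inv_mem _ (hLS 1)) h1
  · exact key g hc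

/-- **An odd-index dicyclic pair in `SL₂(𝔽_q)`, `q` an odd prime**, uniformly in `q`: a generator `a` of the cyclic torus
`C(w)` of `w = (0 -1; 1 0)` and an element `b` inverting it, with `b² = a^k = -1`, `k = ord(a)/2` even, and
`⟨a, b⟩ = N(⟨w⟩)` of odd index (the dicyclic subgroups `Q_{2(q∓1)}` of Brown VI.9 Exercise 8). [folklore] -/
private theorem exists_dicyclic_oddIndex (hq : q ≠ 2) :
    ∃ (a b : SL(2, ZMod q)) (k : ℕ), Even k ∧ b * a * b⁻¹ = a⁻¹ ∧ b ^ 2 = a ^ k ∧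
      (∀ m : ℕ, a ^ (2 * m) = 1 → k ∣ m) ∧ Odd (Subgroup.closure ({a, b} : Set (SL(2, ZMod q)))).index := by
  classical
  let w : SL(2, ZMod q) := ⟨!![0, -1; 1, 0], by simp [Matrix.det_fin_two_of]⟩
  have hw : (w : Matrix (Fin 2) (Fin 2) (ZMod q)) = !![0, -1; 1, 0] := rfl
  have hs : w * w = -1 := mul_self_w hw
  have hs' : w⁻¹ * w⁻¹ = -1 := by rw [inv_eq_neg hs]; simpa using hs
  obtain ⟨j, hj⟩ := exists_conj_eq_of_mul_self_eq_neg_one hq w w⁻¹ hs hs'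
  have hj2 : j * j = -1 := mul_self_eq_neg_one_of_conj_w_eq_inv hw j hj
  have hinv := conj_eq_inv_of_mem_centralizer_w hw j hj
  haveI := isCyclic_centralizer_w hq hw
  obtain ⟨c₀, hC⟩ := (Subgroup.isCyclic_iff_exists_zpowers_eq_top
    (Subgroup.centralizer ({w} : Set (SL(2, ZMod q))))).1 inferInstance
  have hc₀ : c₀ ∈ Subgroup.centralizer ({w} : Set (SL(2, ZMod q))) := by
    rw [← hC]; exact Subgroup.mem_zpowers c₀
  have h4 : 4 ∣ orderOf c₀ := by
    rw [← Nat.card_zpowers, hC]; exact four_dvd_card_centralizer hq hs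
  obtain ⟨k, hk⟩ := h4
  have hkpos : 0 < k := by
    rcases Nat.eq_zero_or_pos k with h0 | h0
    · exfalso; rw [h0, mul_zero] at hk; exact (orderOf_pos c₀).ne' hk
    · exact h0
  -- `c₀ ^ (2k) = -1`
  have hck : c₀ ^ (2 * k) = -1 := by
    have hne : c₀ ^ (2 * k) ≠ 1 := pow_ne_one_of_lt_orderOf (by omega) (by rw [hk]; omega)
    have hsq1 : c₀ ^ (2 * k) * c₀ ^ (2 * k) = 1 := by
      rw [← pow_add, show 2 * k + 2 * k = orderOf c₀ by rw [hk]; ring, pow_orderOf_eq_one]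
    rcases eq_one_or_eq_neg_one_of_mul_self_eq_one hq _ hsq1 with h | h
    · exact absurd h hne
    · exact h
  refine ⟨c₀, j, 2 * k, even_two_mul k, hinv c₀ hc₀, by rw [pow_two, hj2, hck], fun m hm => ?_, ?_⟩
  · -- `c₀ ^ (2m) = 1 ⇒ 4k ∣ 2m ⇒ 2k ∣ m`
    have hdvd : orderOf c₀ ∣ 2 * m := orderOf_dvd_of_pow_eq_one hm
    rw [hk] at hdvd
    obtain ⟨r, hr⟩ := hdvd
    exact ⟨r, Nat.eq_of_mul_eq_mul_left (by norm_num : 0 < 2) (by rw [hr]; ring)⟩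
  · -- `⟨c₀, j⟩ = N(⟨w⟩)`, which has odd index
    have hjw : j⁻¹ * w * j = w⁻¹ := by
      have h1 := hinv w (Subgroup.mem_centralizer_singleton_iff.2 rfl)
      have h2 : j * w⁻¹ * j⁻¹ = w := by
        have := congrArg (·⁻¹) h1
        simpa only [mul_inv_rev, inv_inv, mul_assoc] using this
      calc j⁻¹ * w * j = j⁻¹ * (j * w⁻¹ * j⁻¹) * j := by rw [h2]
        _ = w⁻¹ := by group
    have heq : Subgroup.closure ({c₀, j} : Set (SL(2, ZMod q))) =
        Subgroup.normalizer (Subgroup.zpowers w : Set (SL(2, ZMod q))) := by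
      apply le_antisymm
      · rw [Subgroup.closure_le]
        rintro x (rfl | rfl)
        · rw [SetLike.mem_coe, mem_normalizer_zpowers_iff hq hs]
          left
          rw [mul_inv_eq_iff_eq_mul]
          exact Subgroup.mem_centralizer_singleton_iff.1 hc₀
        · rw [SetLike.mem_coe, mem_normalizer_zpowers_iff hq hs]
          right; exact hj
      · intro g hg
        rw [mem_normalizer_zpowers_iff hq hs] at hg
        have hc₀mem : c₀ ∈ Subgroup.closure ({c₀, j} : Set (SL(2, ZMod q))) := Subgroup.subset_closure (by simp)
        have hjmem : j ∈ Subgroup.closure ({c₀, j} : Set (SL(2, ZMod q))) := Subgroup.subset_closure (by simp)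
        have hCle : Subgroup.zpowers c₀ ≤ Subgroup.closure ({c₀, j} : Set (SL(2, ZMod q))) := by
          rw [Subgroup.zpowers_le]; exact hc₀mem
        rcases hg with h | h
        · apply hCle
          rw [hC, Subgroup.mem_centralizer_singleton_iff, ← mul_inv_eq_iff_eq_mul, h]
        · have hmem : g * j⁻¹ ∈ Subgroup.zpowers c₀ := by
            rw [hC, Subgroup.mem_centralizer_singleton_iff, ← mul_inv_eq_iff_eq_mul]
            calc g * j⁻¹ * w * (g * j⁻¹)⁻¹ = g * (j⁻¹ * w * j) * g⁻¹ := by group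
              _ = g * w⁻¹ * g⁻¹ := by rw [hjw]
              _ = (g * w * g⁻¹)⁻¹ := by group
              _ = w := by rw [h, inv_inv]
          have : g = g * j⁻¹ * j := by group
          rw [this]
          exact Subgroup.mul_mem _ (hCle hmem) hjmem
    rw [heq]
    exact Nat.odd_iff.2 (Nat.two_dvd_ne_zero.1 (not_two_dvd_index_normalizer_zpowers hq hs))

end SL2ZModOddPrime

open SL2ZModOddPrime Literature.GroupTheory.SpecificGroups
  Literature.GroupTheory.CentralExtensionDicyclic

/-- **F-es-27′ holds: the extension criterion EXT-CRIT for `SL₂(𝔽_q)`, `q` an odd prime, `2`-torsion coefficients.**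
For every odd prime `q`, every surjection `π : G ↠ SL(2, ZMod q)`, every abelian group `K` with `y + y = 0`, and every
`G`-stable additive `ψ : ker π → K`, there is a unique additive `Ψ : G → K` restricting to `ψ` — the statement of the named
Literature fact `sl2ZModOddPrime_existsUnique_extension_of_stable_character` (derived reading of Fiedorowicz–Priddy 1978
VI.5.4), proved by the transfer to the odd-index dicyclic normaliser `N(⟨w⟩)` and the dicyclic central-extension
computation (no cohomology).
[cite: FiedorowiczPriddy1978, Ch. VI Prop. 5.4; Brown1982CohomologyGroups, VI.9 Exercise 8 (dicyclic subgroups of SL_2(F_q) of odd index)] -/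
theorem sl2ZModOddPrime_extCrit_of_dicyclicTransfer :
    sl2ZModOddPrime_existsUnique_extension_of_stable_character := by
  intro q hq hq2 G _ π hπ K _ hK ψ hψ hst
  haveI : Fact q.Prime := ⟨hq⟩
  have hqodd : Odd q := hq.odd_of_ne_two hq2
  obtain ⟨a, b, k, hk, hab, hb2, hak, hidx⟩ := exists_dicyclic_oddIndex (q := q) hq2
  exact existsUnique_extension_of_stable_of_dicyclic_oddIndex hqodd (closure_pow_eq_one_eq_top (q := q))
    (fun s hs => hs) hk hab hb2 hak hidx π hπ hK ψ hψ hst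


end Literature.GroupTheory.SpecificGroups

end Part3

/-! ## Part 4 — the EXACT discharge(s) -/

/-- **EXT-CRIT for `SL₂(𝔽_q)`, `q` an odd prime, `2`-torsion coefficients, HOLDS** — the named fact
`Literature.GroupTheory.SpecificGroups.sl2ZModOddPrime_existsUnique_extension_of_stable_character` under its discharge
name of record: for every odd prime `q`, every surjection `π : G ↠ SL(2, ZMod q)`, every abelian group `K` with `y + y = 0`
and every `G`-stable additive `ψ : ker π → K`, there is a unique additive `Ψ : G → K` restricting to `ψ` (derived reading of
Fiedorowicz–Priddy 1978 VI.5.4, `H¹ = H² = 0` mod `2`), proved WITHOUT cohomology — Part 3's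
`sl2ZModOddPrime_extCrit_of_dicyclicTransfer` (transfer to the odd-index dicyclic normaliser `N(⟨w⟩)` of Parts 1–2 and the
tree's `existsUnique_extension_of_stable_of_dicyclic_oddIndex`).  Summits-side twins:
`Summit.BirchSwinnertonDyer.BirchSwinnertonDyer.Theorems.{sl2ZModOddPrime_existsUnique_extension_of_stable_character_holds, stub_sl2OddPrimeExtensionFact}`.
[cite: FiedorowiczPriddy1978, Ch. VI Prop. 5.4; Brown1982CohomologyGroups, VI.9 Exercise 8 (dicyclic subgroups of SL_2(F_q) of odd index)] -/
theorem Literature.GroupTheory.SpecificGroups.sl2ZModOddPrime_existsUnique_extension_of_stable_character_holds :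
    Literature.GroupTheory.SpecificGroups.sl2ZModOddPrime_existsUnique_extension_of_stable_character :=
  Literature.GroupTheory.SpecificGroups.sl2ZModOddPrime_extCrit_of_dicyclicTransfer

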